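import Summits.Parity.BatemanHorn.Theorems.SoloInformedErdosNairClassIVLevel

/-!
# Erdős's bound `∑_{n ≤ N} τ(|g(n)|) ≪ N log N`: Shiu's class IV for polynomial values

Solo informed line (Parity / Bateman–Horn), session 139 — the polynomial analogue of
`Shiu.classIV_bound`: summing `polyClassIV_r_bound` over the level `r = ⌊log z / log P_n⌋ ≤ log z / log L`
with `K₁ = 2M₁ log 2 + 4 log 2`, the saving `e^{−K₁ r/2}` turns `2^{(r+1)M₁}(r+1)` into `2^{M₁} 2^{−r}`
(`Shiu.pow_mul_exp_neg_eq`, `Shiu.succ_div_four_pow_le`), a convergent series: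

* `polyClassIV_bound` — for `w ≥ 2`, `z = w²`, `L ≥ 4` with `log L ≥ 6K₁`, `|g(n)| ≤ X` on `[1, N]`,
  `log X / log z ≤ M₁` and the Mertens-type hypothesis `log u · ∏_{p<u}(1 − ρ_g(p)/p) ≤ K_up` (`u ≥ 2`):
  `∑_{n ≤ N, m_n > z, L < P_n ≤ w, c_n > w} τ(m_n) ≤ 2·2^{M₁} K ((N+z)K_up/log z + z^{5/3}) Λ (∏_{p ≤ ⌊z⌋}(1 − ρ_g(p)/p))⁻²`,
  `Λ = exp(2W(1+D)e^{K₁}(K₁+1))`.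

Everything is PROVED; no definitions, no named facts.  With classes I–III
(`SoloInformedErdosNairClassI–III`) and the small values this completes the class estimates; the
parameter choice and the Mertens conversions (the assembly) follow.

References: P. Shiu, J. reine angew. Math. 313 (1980) 161–170, §5 (`∑_{IV}`) [Shiu1980]; P. Erdős,
J. London Math. Soc. 27 (1952) 7–15 [Erdos1952]; M. Nair, Acta Arith. 62 (1992) 257–269 [Nair1992].
-/

open Finset Real Polynomial

namespace Summit.Parity.BatemanHorn.Theorems

open Literature.NumberTheory.Sieve

namespace ErdosDivisor

/-- **Class IV** (the polynomial analogue of Shiu 1980, §5, `∑_{IV}`).  Let `ρ_g(p) ≤ D`,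
`ρ_g(p) < p`, `ρ_g(p^a) ≤ W` (`W ≥ 1`).  There is `K = K(g) > 0` such that for all `N`, `X`, `w ≥ 2`,
`z = w²`, `L ≥ 4`, `K_up ≥ 0`, `M₁` with `|g(n)| ≤ X` on `[1, N]`, `log X / log z ≤ M₁`,
`6(2M₁ log 2 + 4 log 2) ≤ log L` and `log u · ∏_{p<u}(1 − ρ_g(p)/p) ≤ K_up` for all `u ≥ 2`:
`∑_{n ≤ N, m_n > z, L < P_n ≤ w, c_n > w} τ(m_n)`
`≤ 2 · 2^{M₁} K ((N+z)K_up/log z + z^{2/3} z) exp(2W(1+D)e^{K₁}(K₁+1)) (∏_{p ≤ ⌊z⌋}(1 − ρ_g(p)/p))⁻²`,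
`K₁ = 2M₁ log 2 + 4 log 2`. [cite: Shiu1980, §5 (∑_IV)]; [this work] -/
theorem polyClassIV_bound {g : ℤ[X]} (hg : HasNoFixedPrimeDivisor ![g]) {D : ℕ} {W : ℝ}
    (hD : ∀ p : ℕ, p.Prime → polyRootCountMod ![g] p ≤ D)
    (hW : ∀ p : ℕ, p.Prime → ∀ a : ℕ, (polyRootCountMod ![g] (p ^ a) : ℝ) ≤ W) (hW1 : 1 ≤ W) :
    ∃ K : ℝ, 0 < K ∧ ∀ (N : ℕ) (X z w L Kup : ℝ) (M₁ : ℕ), 2 ≤ w → w * w = z → 4 ≤ L →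
      (∀ n ∈ Icc 1 N, (((g.eval (n : ℤ)).natAbs : ℕ) : ℝ) ≤ X) → Real.log X / Real.log z ≤ M₁ →
      6 * (2 * M₁ * Real.log 2 + 4 * Real.log 2) ≤ Real.log L → 0 ≤ Kup →
      (∀ u : ℝ, 2 ≤ u →
        Real.log u * ∏ p ∈ Nat.primesBelow ⌈u⌉₊, (1 - (polyRootCountMod ![g] p : ℝ) / p) ≤ Kup) →
        ∑ n ∈ (Icc 1 N).filter (fun n : ℕ => z < (((g.eval (n : ℤ)).natAbs : ℕ) : ℝ) ∧
            L < (Shiu.cutPrime z (g.eval (n : ℤ)).natAbs : ℝ) ∧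
            (Shiu.cutPrime z (g.eval (n : ℤ)).natAbs : ℝ) ≤ w ∧
            w < (Shiu.cPart z (g.eval (n : ℤ)).natAbs : ℝ)),
            (#((g.eval (n : ℤ)).natAbs.divisors) : ℝ) ≤
          2 * 2 ^ M₁ * K * (((N : ℝ) + z) * Kup / Real.log z + z ^ (2 / 3 : ℝ) * z) *
            Real.exp (2 * W * (1 + D) * Real.exp (2 * M₁ * Real.log 2 + 4 * Real.log 2) *
              (2 * M₁ * Real.log 2 + 4 * Real.log 2 + 1)) *
            ((∏ p ∈ Nat.primesLE ⌊z⌋₊, (1 - (polyRootCountMod ![g] p : ℝ) / p)) ^ 2)⁻¹ := by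
  classical
  obtain ⟨K, hK, hlev⟩ := polyClassIV_r_bound hg hD hW hW1
  refine ⟨K, hK, fun N X z w L Kup M₁ hw hwz hL hX hM₁ hLK hKup hPu => ?_⟩
  -- notation
  set K₁ : ℝ := 2 * M₁ * Real.log 2 + 4 * Real.log 2 with hK₁
  set Pz : ℝ := ∏ p ∈ Nat.primesLE ⌊z⌋₊, (1 - (polyRootCountMod ![g] p : ℝ) / p) with hPz
  set Λ : ℝ := Real.exp (2 * W * (1 + D) * Real.exp K₁ * (K₁ + 1)) with hΛ
  set A : ℝ := ((N : ℝ) + z) * Kup / Real.log z with hA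
  set Z : ℝ := z ^ (2 / 3 : ℝ) * z with hZ
  set T := (Icc 1 N).filter (fun n : ℕ => z < (((g.eval (n : ℤ)).natAbs : ℕ) : ℝ) ∧
      L < (Shiu.cutPrime z (g.eval (n : ℤ)).natAbs : ℝ) ∧
      (Shiu.cutPrime z (g.eval (n : ℤ)).natAbs : ℝ) ≤ w ∧
      w < (Shiu.cPart z (g.eval (n : ℤ)).natAbs : ℝ)) with hT
  have hl2 : 0 ≤ Real.log 2 := Real.log_nonneg one_le_two
  have hK₁0 : 0 ≤ K₁ := by positivity
  have hw0 : 0 < w := by linarith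
  have hz4 : 4 ≤ z := by nlinarith
  have hz0 : 0 < z := by linarith
  have hlogz : 0 < Real.log z := Real.log_pos (by linarith)
  have hlogL : 0 < Real.log L := Real.log_pos (by linarith)
  have hPz0 : 0 < Pz := prod_primesLE_pos hg z
  have hΛ0 : 0 < Λ := Real.exp_pos _
  have hA0 : 0 ≤ A := div_nonneg (by positivity) hlogz.le
  have hZ0 : 0 ≤ Z := by positivity
  -- fibre by the level `r`
  set R := ⌊Real.log z / Real.log L⌋₊ with hR
  set lv : ℕ → ℕ := fun n =>
    ⌊Real.log z / Real.log (Shiu.cutPrime z (g.eval (n : ℤ)).natAbs)⌋₊ with hlv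
  have hmaps : ∀ n ∈ T, lv n ∈ range (R + 1) := by
    intro n hn
    obtain ⟨-, hLP, -, -⟩ := (mem_filter.1 hn).2
    rw [mem_range, Nat.lt_succ_iff, hlv, hR]
    refine Nat.floor_le_floor (div_le_div_of_nonneg_left hlogz.le hlogL ?_)
    exact Real.log_le_log (by linarith) hLP.le
  rw [← sum_fiberwise_of_maps_to hmaps]
  -- each level
  have hfib : ∀ r ∈ range (R + 1),
      ∑ n ∈ T.filter (fun n : ℕ => lv n = r), (#((g.eval (n : ℤ)).natAbs.divisors) : ℝ) ≤
        2 ^ M₁ * (1 / 2 : ℝ) ^ r * K * (A + Z) * Λ * (Pz ^ 2)⁻¹ := by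
    intro r _
    have hset : T.filter (fun n : ℕ => lv n = r) = (Icc 1 N).filter (fun n : ℕ =>
        z < (((g.eval (n : ℤ)).natAbs : ℕ) : ℝ) ∧
        L < (Shiu.cutPrime z (g.eval (n : ℤ)).natAbs : ℝ) ∧
        (Shiu.cutPrime z (g.eval (n : ℤ)).natAbs : ℝ) ≤ w ∧
        w < (Shiu.cPart z (g.eval (n : ℤ)).natAbs : ℝ) ∧
        ⌊Real.log z / Real.log (Shiu.cutPrime z (g.eval (n : ℤ)).natAbs)⌋₊ = r) := by
      rw [hT, filter_filter]
      simp only [and_assoc, hlv]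
    rw [hset]
    have h := hlev N X z w L Kup K₁ M₁ r hw hwz hL hX hM₁ hK₁0 hLK hKup hPu
    rw [← hA, ← hZ, ← hΛ, ← hPz] at h
    have hsave : (2 : ℝ) ^ ((r + 1) * M₁) * Real.exp (-(K₁ * r / 2)) = 2 ^ M₁ / 4 ^ r := by
      rw [hK₁]; exact Shiu.pow_mul_exp_neg_eq two_pos M₁ r
    rw [hsave] at h
    refine h.trans ?_
    have hrA : ((r : ℝ) + 1) * A + Z ≤ ((r : ℝ) + 1) * (A + Z) := by
      have : (1 : ℝ) ≤ (r : ℝ) + 1 := by linarith [(Nat.cast_nonneg r : (0 : ℝ) ≤ r)]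
      nlinarith
    calc 2 ^ M₁ / 4 ^ r * K * (((r : ℝ) + 1) * A + Z) * Λ * (Pz ^ 2)⁻¹
        ≤ 2 ^ M₁ / 4 ^ r * K * (((r : ℝ) + 1) * (A + Z)) * Λ * (Pz ^ 2)⁻¹ := by gcongr
      _ = 2 ^ M₁ * (((r : ℝ) + 1) / 4 ^ r) * K * (A + Z) * Λ * (Pz ^ 2)⁻¹ := by ring
      _ ≤ 2 ^ M₁ * (1 / 2 : ℝ) ^ r * K * (A + Z) * Λ * (Pz ^ 2)⁻¹ := by
          gcongr
          exact Shiu.succ_div_four_pow_le r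
  refine (sum_le_sum hfib).trans ?_
  have hgeom := sum_geometric_two_le (R + 1)
  calc ∑ r ∈ range (R + 1), 2 ^ M₁ * (1 / 2 : ℝ) ^ r * K * (A + Z) * Λ * (Pz ^ 2)⁻¹
      = 2 ^ M₁ * K * (A + Z) * Λ * (Pz ^ 2)⁻¹ * ∑ r ∈ range (R + 1), (1 / 2 : ℝ) ^ r := by
        rw [mul_sum]; exact sum_congr rfl fun r _ => by ring
    _ ≤ 2 ^ M₁ * K * (A + Z) * Λ * (Pz ^ 2)⁻¹ * 2 :=
        mul_le_mul_of_nonneg_left hgeom (by positivity)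
    _ = 2 * 2 ^ M₁ * K * (A + Z) * Λ * (Pz ^ 2)⁻¹ := by ring

end ErdosDivisor

end Summit.Parity.BatemanHorn.Theorems
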